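import Summits.HodgeConjecture.HodgeConjecture.Theorems.Ring2WeilCoverageCMFieldNormResidueSymbolsLocal
import Summits.HodgeConjecture.HodgeConjecture.Theorems.Ring2WeilCoverageCMFieldNormDescent
import Mathlib.Tactic.ComputeDegree
import HarnessLib

/-!
# Ring 2 — Weil-family coverage, CM-field rows: residue fields and uniqueness of the DYADIC places of the real
  quadratic fields `F = ℚ(θ)` of the census carriers — toolkit for sub-cell (ix″) (WEIL-FAMILY-COVERAGE «## b03», part 7)

research route conditional on HC_CM; not a corollary; Q11.4-sentence-2 already refuted in dim ≥ 3.

The dyadic half of the closed form of the row index `δ ∈ F^×/Nm_{E/F}(E^×)` (`Ring2WeilCoverageCMFieldNormResidueSymbolsDyadic`: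
`v ∈ T(q) ⟺ (X² - X - ρ irreducible mod v) ∧ ord_v q odd` at `v ∣ 2` under `θ = c²(1 + 4ρ)`; the parity complement at a
unique dyadic place) is instantiated on a carrier `R = S² + pS + q` [cite: Deligne1982HodgeCycles, §4 p. 30 and (1)] from
three elementary facts about the places `v ∣ 2` of the real quadratic field `F = 𝓞_F ⊗ ℚ`, proved here for ANY number
field `K` of degree `2` from Mathlib's ideal norm (`Ideal.absNorm`, `|𝓞_K/v| = N v`, `N(2) = 2^{[K:ℚ]}`):

* §13 `pow_absNorm_sub_self_mem` (`x^{N v} ≡ x`), `pow_four_sub_self_mem_of_dyadic` (`[K:ℚ] = 2`, `v ∣ 2`: `x⁴ ≡ x`,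
  as `N v ∣ 4`); for `2` RAMIFIED, witnessed by `π² = 2u` with `u` a unit: `N v = 2` (`x² ≡ x`), `v = (π)` is the UNIQUE
  dyadic place and `ord_v 2 = 2` (`…_of_sq_eq_two_mul_unit`); for `2` INERT, witnessed by some `x² - x ∉ v`: `N v = 4`,
  `v = (2)` is the unique dyadic place and `ord_v 2 = 1` (`…_of_sq_sub_self_notMem`); two ideals `J ≤ I` with the same
  norm are equal; odd integers are dyadic units. [folklore]
* §14 for a quadratic carrier: `[F:ℚ] = 2` and the relation `θₒ² + pθₒ + q = 0` in `𝓞_F` for an integral lift `θₒ` of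
  `θ`.
The sequel `Ring2WeilCoverageCMFieldNormResidueSymbolsDyadicCarriers` decides with these the dyadic column of the `T`-labels
for `ℚ(ζ₅)` (inert), `ℚ(ζ₁₂)` (inert, `2` ramified in `ℚ(√3)`), `ℚ(√-3,√5)` (split).  No new definition, no named fact,
no sorry; nothing about the Hodge conjecture is asserted.
-/

noncomputable section

set_option linter.dupNamespace false

open Polynomial NumberField IsDedekindDomain

namespace Summit.HodgeConjecture.HodgeConjecture.Ring2.WeilCoverageCM

open Literature.AlgebraicGeometry.Deligne1982

/-! ### §13 Residue fields at the dyadic places of a real quadratic field (toolkit) -/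

section Toolkit

variable {K : Type*} [Field K] [NumberField K]

/-- `|𝓞_K / (2)| = 2^{[K:ℚ]}` (`N(2) = 2^{[K:ℚ]}`). [folklore] -/
theorem absNorm_span_two : Ideal.absNorm (Ideal.span {(2 : 𝓞 K)}) = 2 ^ Module.finrank ℚ K := by
  rw [Ideal.absNorm_span_singleton, show (2 : 𝓞 K) = algebraMap ℤ (𝓞 K) 2 by simp, Algebra.norm_algebraMap,
    NumberField.RingOfIntegers.rank, Int.natAbs_pow]
  rfl

/-- **`x^{N v} ≡ x (mod v)`** for every `x ∈ 𝓞_K` and every finite place `v` (`𝓞_K/v` is a field with `N v` elements).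
[folklore] -/
theorem pow_absNorm_sub_self_mem (v : HeightOneSpectrum (𝓞 K)) (x : 𝓞 K) :
    x ^ Ideal.absNorm v.asIdeal - x ∈ v.asIdeal := by
  classical
  haveI : Finite (𝓞 K ⧸ v.asIdeal) := v.asIdeal.finiteQuotientOfFreeOfNeBot v.ne_bot
  letI : Fintype (𝓞 K ⧸ v.asIdeal) := Fintype.ofFinite _
  haveI : v.asIdeal.IsMaximal := v.isMaximal
  letI : Field (𝓞 K ⧸ v.asIdeal) := Ideal.Quotient.field v.asIdeal
  have hcard : Fintype.card (𝓞 K ⧸ v.asIdeal) = Ideal.absNorm v.asIdeal := by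
    rw [← Nat.card_eq_fintype_card, Ideal.absNorm_apply, Submodule.cardQuot_apply]
  rw [← Ideal.Quotient.eq_zero_iff_mem, map_sub, map_pow, ← hcard, FiniteField.pow_card, sub_self]

/-- At a DYADIC place `v` of a number field of degree `2`: `N v ∣ 4`. [folklore] -/
theorem absNorm_dvd_four_of_dyadic (hK : Module.finrank ℚ K = 2) (v : HeightOneSpectrum (𝓞 K))
    (h2 : (2 : 𝓞 K) ∈ v.asIdeal) : Ideal.absNorm v.asIdeal ∣ 4 := by
  have h := Ideal.absNorm_dvd_absNorm_of_le ((Ideal.span_singleton_le_iff_mem _).2 h2)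
  rwa [absNorm_span_two, hK] at h

/-- **`x⁴ ≡ x (mod v)` at every dyadic place of a QUADRATIC number field** (`|𝓞_K/v| ∈ {2, 4}`). [folklore] -/
theorem pow_four_sub_self_mem_of_dyadic (hK : Module.finrank ℚ K = 2) (v : HeightOneSpectrum (𝓞 K))
    (h2 : (2 : 𝓞 K) ∈ v.asIdeal) (x : 𝓞 K) : x ^ 4 - x ∈ v.asIdeal := by
  have hdvd := absNorm_dvd_four_of_dyadic hK v h2
  have hne1 : Ideal.absNorm v.asIdeal ≠ 1 := fun h1 ↦ v.isPrime.ne_top (Ideal.absNorm_eq_one_iff.1 h1)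
  have hx := pow_absNorm_sub_self_mem v x
  have h4 : (4 : ℕ) = 2 ^ 2 := by norm_num
  rw [h4, Nat.dvd_prime_pow Nat.prime_two] at hdvd
  obtain ⟨i, hi, heq⟩ := hdvd
  interval_cases i
  · rw [pow_zero] at heq; exact absurd heq hne1
  · rw [heq, pow_one] at hx
    have : x ^ 4 - x = (x ^ 2 - x) * (x ^ 2 + x + 1) := by ring
    rw [this]
    exact v.asIdeal.mul_mem_right _ hx
  · rwa [heq] at hx

/-- **A RAMIFIED dyadic place of a quadratic number field has residue field `𝔽₂`**: if `π² = 2u` with `u` a unit of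
`𝓞_K` (`K` quadratic) then `N v = 2` at every dyadic `v` (`N(π)² = N(2) = 4`, `π ∈ v`). [folklore] -/
theorem absNorm_eq_two_of_dyadic_of_sq_eq_two_mul_unit (hK : Module.finrank ℚ K = 2) {π u : 𝓞 K} (hu : IsUnit u)
    (hπ : π ^ 2 = 2 * u) (v : HeightOneSpectrum (𝓞 K)) (h2 : (2 : 𝓞 K) ∈ v.asIdeal) :
    Ideal.absNorm v.asIdeal = 2 := by
  have hNπ : Ideal.absNorm (Ideal.span {π}) = 2 := by
    have h := congrArg Ideal.absNorm (Ideal.span_singleton_pow π 2)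
    rw [map_pow, hπ, ← Ideal.span_singleton_mul_span_singleton, map_mul, absNorm_span_two, hK,
      Ideal.span_singleton_eq_top.2 hu, Ideal.absNorm_top, mul_one] at h
    have h' : Ideal.absNorm (Ideal.span {π}) * Ideal.absNorm (Ideal.span {π}) = 2 * 2 := by rw [← sq, h]; norm_num
    exact Nat.mul_self_inj.1 h'
  have hπv : π ∈ v.asIdeal := by
    have : π ^ 2 ∈ v.asIdeal := by rw [hπ]; exact v.asIdeal.mul_mem_right _ h2
    exact v.isPrime.mem_of_pow_mem 2 this
  have hdvd := Ideal.absNorm_dvd_absNorm_of_le ((Ideal.span_singleton_le_iff_mem _).2 hπv)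
  rw [hNπ, Nat.dvd_prime Nat.prime_two] at hdvd
  exact hdvd.resolve_left fun h1 ↦ v.isPrime.ne_top (Ideal.absNorm_eq_one_iff.1 h1)

/-- Hence **`x² ≡ x (mod v)`** at every dyadic place of a quadratic field in which `2` ramifies (`π² = 2u`). [folklore] -/
theorem sq_sub_self_mem_of_dyadic_of_sq_eq_two_mul_unit (hK : Module.finrank ℚ K = 2) {π u : 𝓞 K} (hu : IsUnit u)
    (hπ : π ^ 2 = 2 * u) (v : HeightOneSpectrum (𝓞 K)) (h2 : (2 : 𝓞 K) ∈ v.asIdeal) (x : 𝓞 K) :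
    x ^ 2 - x ∈ v.asIdeal := by
  have hx := pow_absNorm_sub_self_mem v x
  rwa [absNorm_eq_two_of_dyadic_of_sq_eq_two_mul_unit hK hu hπ v h2] at hx

/-- Two ideals `J ≤ I` of `𝓞_K` with the same (non-zero) norm are EQUAL (`J = I·I'`, `N(I') = 1`). [folklore] -/
theorem ideal_eq_of_le_of_absNorm_eq {I J : Ideal (𝓞 K)} (hle : J ≤ I) (hI : Ideal.absNorm I ≠ 0)
    (h : Ideal.absNorm J = Ideal.absNorm I) : J = I := by
  obtain ⟨I', hJ⟩ := Ideal.dvd_iff_le.2 hle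
  have h1 : Ideal.absNorm I * Ideal.absNorm I' = Ideal.absNorm I * 1 := by rw [← map_mul, ← hJ, h, mul_one]
  have hI' : I' = ⊤ := Ideal.absNorm_eq_one_iff.1 (Nat.eq_of_mul_eq_mul_left (Nat.pos_of_ne_zero hI) h1)
  rw [hJ, hI', Ideal.mul_top]

/-- **The dyadic place of a quadratic field with `2` RAMIFIED is unique and principal**: `v = (π)` for every dyadic
`v` (`π² = 2u`). [folklore] -/
theorem asIdeal_eq_span_of_dyadic_of_sq_eq_two_mul_unit (hK : Module.finrank ℚ K = 2) {π u : 𝓞 K} (hu : IsUnit u)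
    (hπ : π ^ 2 = 2 * u) (v : HeightOneSpectrum (𝓞 K)) (h2 : (2 : 𝓞 K) ∈ v.asIdeal) :
    v.asIdeal = Ideal.span {π} := by
  have hπv : π ∈ v.asIdeal := by
    have : π ^ 2 ∈ v.asIdeal := by rw [hπ]; exact v.asIdeal.mul_mem_right _ h2
    exact v.isPrime.mem_of_pow_mem 2 this
  have hNv := absNorm_eq_two_of_dyadic_of_sq_eq_two_mul_unit hK hu hπ v h2
  -- `N(π) = 2` as well: the place `v` itself shows `(π) ≠ ⊤`, and `N((π))² = 4`
  have hNπ : Ideal.absNorm (Ideal.span {π}) = 2 := by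
    have h := congrArg Ideal.absNorm (Ideal.span_singleton_pow π 2)
    rw [map_pow, hπ, ← Ideal.span_singleton_mul_span_singleton, map_mul, absNorm_span_two, hK,
      Ideal.span_singleton_eq_top.2 hu, Ideal.absNorm_top, mul_one] at h
    have h' : Ideal.absNorm (Ideal.span {π}) * Ideal.absNorm (Ideal.span {π}) = 2 * 2 := by rw [← sq, h]; norm_num
    exact Nat.mul_self_inj.1 h'
  exact (ideal_eq_of_le_of_absNorm_eq ((Ideal.span_singleton_le_iff_mem _).2 hπv) (by rw [hNv]; norm_num)
    (by rw [hNπ, hNv])).symm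

/-- So any two dyadic places of such a field coincide. [folklore] -/
theorem dyadic_unique_of_sq_eq_two_mul_unit (hK : Module.finrank ℚ K = 2) {π u : 𝓞 K} (hu : IsUnit u)
    (hπ : π ^ 2 = 2 * u) (v v' : HeightOneSpectrum (𝓞 K)) (h2 : (2 : 𝓞 K) ∈ v.asIdeal)
    (h2' : (2 : 𝓞 K) ∈ v'.asIdeal) : v = v' :=
  HeightOneSpectrum.ext (by rw [asIdeal_eq_span_of_dyadic_of_sq_eq_two_mul_unit hK hu hπ v h2,
    asIdeal_eq_span_of_dyadic_of_sq_eq_two_mul_unit hK hu hπ v' h2'])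

/-- And `ord_v 2 = 2` there: `v(2) = exp(-2)` (`(2) = (π)² = v²`). [folklore] -/
theorem intValuation_two_of_dyadic_of_sq_eq_two_mul_unit (hK : Module.finrank ℚ K = 2) {π u : 𝓞 K}
    (hu : IsUnit u) (hπ : π ^ 2 = 2 * u) (v : HeightOneSpectrum (𝓞 K)) (h2 : (2 : 𝓞 K) ∈ v.asIdeal) :
    v.intValuation (2 : 𝓞 K) = WithZero.exp (-2 : ℤ) := by
  have hv := asIdeal_eq_span_of_dyadic_of_sq_eq_two_mul_unit hK hu hπ v h2
  have hπ0 : π ≠ 0 := by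
    rintro rfl
    rw [Ideal.span_singleton_eq_bot.2 rfl] at hv
    exact v.ne_bot hv
  have hvπ : v.intValuation π = WithZero.exp (-1 : ℤ) := HeightOneSpectrum.intValuation_singleton (v := v) hπ0 hv
  have huv : v.intValuation u = 1 := by
    refine HeightOneSpectrum.intValuation_eq_one_iff.2 fun hmem ↦ v.isPrime.ne_top ?_
    exact (Ideal.eq_top_iff_one _).2 (by
      obtain ⟨w, rfl⟩ := hu
      have := v.asIdeal.mul_mem_left (↑w⁻¹ : 𝓞 K) hmem
      rwa [Units.inv_mul] at this)
  have h := congrArg v.intValuation hπ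
  rw [map_pow, hvπ, map_mul, huv, mul_one, ← WithZero.exp_nsmul] at h
  rw [← h]
  norm_num

/-- **At an INERT-type dyadic place of a quadratic field** (`N v = 4`): `v = (2)`, so the dyadic place is unique and
`ord_v 2 = 1`. Criterion used: `N v ≠ 2`, i.e. some `x ∈ 𝓞_K` has `x² - x ∉ v`. [folklore] -/
theorem asIdeal_eq_span_two_of_dyadic_of_sq_sub_self_notMem (hK : Module.finrank ℚ K = 2)
    (v : HeightOneSpectrum (𝓞 K)) (h2 : (2 : 𝓞 K) ∈ v.asIdeal) {x : 𝓞 K} (hx : x ^ 2 - x ∉ v.asIdeal) :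
    v.asIdeal = Ideal.span {(2 : 𝓞 K)} := by
  have hdvd := absNorm_dvd_four_of_dyadic hK v h2
  have hne1 : Ideal.absNorm v.asIdeal ≠ 1 := fun h1 ↦ v.isPrime.ne_top (Ideal.absNorm_eq_one_iff.1 h1)
  have hne2 : Ideal.absNorm v.asIdeal ≠ 2 := fun h ↦ by
    have hx' := pow_absNorm_sub_self_mem v x
    rw [h] at hx'
    exact hx hx'
  have h4 : Ideal.absNorm v.asIdeal = 4 := by
    have h4' : (4 : ℕ) = 2 ^ 2 := by norm_num
    rw [h4', Nat.dvd_prime_pow Nat.prime_two] at hdvd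
    obtain ⟨i, hi, heq⟩ := hdvd
    interval_cases i
    · rw [pow_zero] at heq; exact absurd heq hne1
    · rw [pow_one] at heq; exact absurd heq hne2
    · rw [heq]; norm_num
  refine (ideal_eq_of_le_of_absNorm_eq ((Ideal.span_singleton_le_iff_mem _).2 h2) ?_ ?_).symm
  · rw [h4]; norm_num
  · rw [absNorm_span_two, hK, h4]; norm_num

/-- … hence `ord_v 2 = 1` there: `v(2) = exp(-1)`. [folklore] -/
theorem intValuation_two_of_dyadic_of_sq_sub_self_notMem (hK : Module.finrank ℚ K = 2)
    (v : HeightOneSpectrum (𝓞 K)) (h2 : (2 : 𝓞 K) ∈ v.asIdeal) {x : 𝓞 K} (hx : x ^ 2 - x ∉ v.asIdeal) :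
    v.intValuation (2 : 𝓞 K) = WithZero.exp (-1 : ℤ) :=
  HeightOneSpectrum.intValuation_singleton (v := v) two_ne_zero
    (asIdeal_eq_span_two_of_dyadic_of_sq_sub_self_notMem hK v h2 hx)

/-- … and the dyadic place is unique. [folklore] -/
theorem dyadic_unique_of_sq_sub_self_notMem (hK : Module.finrank ℚ K = 2)
    (v v' : HeightOneSpectrum (𝓞 K)) (h2 : (2 : 𝓞 K) ∈ v.asIdeal) (h2' : (2 : 𝓞 K) ∈ v'.asIdeal)
    {x : 𝓞 K} (hx : x ^ 2 - x ∉ v.asIdeal) (hx' : x ^ 2 - x ∉ v'.asIdeal) : v = v' :=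
  HeightOneSpectrum.ext (by rw [asIdeal_eq_span_two_of_dyadic_of_sq_sub_self_notMem hK v h2 hx,
    asIdeal_eq_span_two_of_dyadic_of_sq_sub_self_notMem hK v' h2' hx'])

omit [NumberField K] in
/-- An ODD integer is a unit at every dyadic place. [folklore] -/
theorem intCast_notMem_of_odd (v : HeightOneSpectrum (𝓞 K)) (h2 : (2 : 𝓞 K) ∈ v.asIdeal) {w : ℤ} (hw : Odd w) :
    (w : 𝓞 K) ∉ v.asIdeal := by
  obtain ⟨m, rfl⟩ := hw
  intro h
  have h1 : (1 : 𝓞 K) ∈ v.asIdeal := by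
    have e : ((2 * m + 1 : ℤ) : 𝓞 K) = 2 * (m : 𝓞 K) + 1 := by push_cast; ring
    rw [e] at h
    have := v.asIdeal.sub_mem h (v.asIdeal.mul_mem_right (m : 𝓞 K) h2)
    rwa [add_sub_cancel_left] at this
  exact v.isPrime.ne_top ((Ideal.eq_top_iff_one _).2 h1)

end Toolkit

/-! ### §14 Quadratic carriers `R = S² + pS + q`: the degree and the root relation in `𝓞_F` -/

section Carriers

variable {R : Polynomial ℤ} [Fact (Irreducible (realPolyQ R))]

/-- `[F:ℚ] = 2` for a quadratic carrier `R = S² + pS + q`. [cite: Deligne1982HodgeCycles, §4 p. 30] -/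
theorem finrank_realField_quadratic {p q : ℤ} (hR : R = X ^ 2 + C p * X + C q) :
    Module.finrank ℚ (realField R) = 2 := by
  rw [finrank_realField, hR]; compute_degree!

/-- `θₒ² + pθₒ + q = 0` in `𝓞_F` for `(θₒ : F) = θ`, `R = S² + pS + q`. [cite: Deligne1982HodgeCycles, §4 p. 30] -/
theorem ringOfIntegers_root_rel_quadratic {p q : ℤ} (hR : R = X ^ 2 + C p * X + C q) {θₒ : 𝓞 (realField R)}
    (hθ : (θₒ : realField R) = AdjoinRoot.root (realPolyQ R)) : θₒ ^ 2 + p * θₒ + q = 0 := by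
  have h := root_rel_quadratic hR
  rw [← hθ] at h
  refine RingOfIntegers.ext ?_
  simp only [map_add, map_mul, map_pow, map_intCast, map_zero]
  exact_mod_cast h

end Carriers

end Summit.HodgeConjecture.HodgeConjecture.Ring2.WeilCoverageCM

end
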